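import Mathlib.MeasureTheory.Integral.IntervalIntegral.AbsolutelyContinuousFun
import Mathlib.MeasureTheory.Integral.Prod
import Mathlib.Analysis.Calculus.ContDiff.RCLike
import Mathlib.Analysis.Calculus.ContDiff.Basic
import Mathlib.Analysis.Calculus.Deriv.Comp
import Mathlib.Analysis.Calculus.Deriv.Mul
import HarnessLib

/-!
# The chain rule for an equation in time-integrated form

Analysis/FluidPDE proofs file (theorems only). In the tree, evolution equations whose solutions
are only Lipschitz in time (bounded ancient solutions of Navier–Stokes: KNSS 2009, §4 (4.8);
the swirl equation (5.10) of `KNSS2009_regularity_axisymmetric_swirl`) are vendored in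
**time-integrated form** `g(t) − g(s) = ∫ₛᵗ n(τ) dτ`. Energy methods test such an equation
with nonlinear functions of the solution (`q|Γ|^{2q−2}Γ ψ²` in Lei–Zhang, J. Funct. Anal. 261
(2011) = arXiv:1011.5066, §2 (2.2); `pΦ^{p−1}ψ²` in Lemma 3.4; `ζ²/Φ̃` in Lemma 3.2), which
requires the chain rule `∂ₜ H(g) = H'(g) ∂ₜ g` for the merely absolutely continuous `t ↦ g(t)`.
This file provides it, from Mathlib's absolutely continuous functions
(`AbsolutelyContinuousOnInterval`: Lebesgue differentiation `IntervalIntegrable.ae_hasDerivAt_integral`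
and the fundamental theorem of calculus `AbsolutelyContinuousOnInterval.integral_deriv_eq_sub`):

* `AbsolutelyContinuousOnInterval.comp_of_lipschitzOnWith` — a Lipschitz function of an
  absolutely continuous function is absolutely continuous;
* `comp_mul_sub_comp_mul_eq_integral` — **the integrated chain rule**: if
  `g(s) = g(a) + ∫ₐˢ n` on `[a, b]` with `n` integrable, and `H, η ∈ C¹`, then
  `H(g(b)) η(b) − H(g(a)) η(a) = ∫ₐᵇ (H'(g) n η + H(g) η') ds`;
* `integral_comp_mul_sub_eq_integral_integral` — the same under an integral `∫ … w(x) dμ(x)`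
  (Fubini), i.e. the energy identity in time for an equation in time-integrated form;
  `integral_comp_mul_sub_eq_integral_integral_ae` with the equation assumed for a.e. `x` only.

## References

* Z. Lei, Q. S. Zhang, J. Funct. Anal. 261 (2011) = arXiv:1011.5066, §2 (2.2)–(2.3) (testing
  (1.5) by `q|Γ|^{2q−2}Γψ²`), p. 6. [LeiZhang2011]
* G. Koch, N. Nadirashvili, G. Seregin, V. Šverák, Acta Math. 203 (2009), §4 (4.8) and (5.10)
  (time-Lipschitz bounded ancient solutions). [KochNadirashviliSereginSverak2009]
-/

noncomputable section

open MeasureTheory Set Filter intervalIntegral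
open scoped Topology NNReal

namespace Literature.Analysis.FluidPDE

/-- **A Lipschitz function of an absolutely continuous function is absolutely continuous**: if
`f` is absolutely continuous on `uIcc a b` with values in `S` there and `H` is `K`-Lipschitz on
`S`, then `H ∘ f` is absolutely continuous on `uIcc a b` (the `ε`–`δ` definition). [folklore] -/
theorem _root_.AbsolutelyContinuousOnInterval.comp_of_lipschitzOnWith {f : ℝ → ℝ} {a b : ℝ}
    (hf : AbsolutelyContinuousOnInterval f a b) {H : ℝ → ℝ} {K : ℝ≥0} {S : Set ℝ}
    (hH : LipschitzOnWith K H S) (hS : MapsTo f (uIcc a b) S) :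
    AbsolutelyContinuousOnInterval (fun x => H (f x)) a b := by
  rw [absolutelyContinuousOnInterval_iff] at hf ⊢
  intro ε hε
  obtain ⟨δ, hδ, hfδ⟩ := hf (ε / (K + 1)) (by positivity)
  refine ⟨δ, hδ, fun E hE hsum => ?_⟩
  have hlt := hfδ E hE hsum
  have hdist : ∀ x ∈ S, ∀ y ∈ S, dist (H x) (H y) ≤ K * dist x y := fun x hx y hy => by
    have h := hH hx hy
    rw [edist_dist, edist_dist, ← ENNReal.ofReal_coe_nnreal,
      ← ENNReal.ofReal_mul (by positivity)] at h
    exact (ENNReal.ofReal_le_ofReal_iff (by positivity)).1 h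
  calc ∑ i ∈ Finset.range E.1, dist (H (f (E.2 i).1)) (H (f (E.2 i).2))
      ≤ ∑ i ∈ Finset.range E.1, K * dist (f (E.2 i).1) (f (E.2 i).2) := by
        refine Finset.sum_le_sum fun i hi => ?_
        exact hdist _ (hS (hE.1 i hi).1) _ (hS (hE.1 i hi).2)
    _ = K * ∑ i ∈ Finset.range E.1, dist (f (E.2 i).1) (f (E.2 i).2) := (Finset.mul_sum _ _ _).symm
    _ ≤ K * (ε / (K + 1)) := by gcongr
    _ < (K + 1) * (ε / (K + 1)) := by gcongr; linarith
    _ = ε := by field_simp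

/-- **The chain rule in time-integrated form.** Let `n` be integrable on `[a, b]` and
`g(s) = g(a) + ∫ₐˢ n` for `s ∈ [a, b]` (so `g` is absolutely continuous with `g' = n` a.e.),
and let `H, η ∈ C¹(ℝ)`. Then
`H(g(b)) η(b) − H(g(a)) η(a) = ∫ₐᵇ (H'(g(s)) n(s) η(s) + H(g(s)) η'(s)) ds`.
(`H ∘ g` is absolutely continuous because `g` is bounded on `[a, b]` and `H` is Lipschitz on
bounded sets; then the fundamental theorem of calculus for the absolutely continuous
`(H ∘ g) η` and Lebesgue's differentiation theorem for `∫ₐˢ n`.) This is the step "testing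
(1.5) by `q|Γ|^{2q−2}Γψ²` gives (2.2)" of Lei–Zhang 2011 for solutions known only in
time-integrated form. [cite: LeiZhang2011, §2 (2.2) (arXiv p. 6), testing the time-integrated equation] -/
theorem comp_mul_sub_comp_mul_eq_integral {g n : ℝ → ℝ} {a b : ℝ} (hab : a ≤ b)
    (hn : IntervalIntegrable n volume a b) (hg : ∀ s ∈ Icc a b, g s = g a + ∫ r in a..s, n r)
    {H : ℝ → ℝ} (hH : ContDiff ℝ 1 H) {η : ℝ → ℝ} (hη : ContDiff ℝ 1 η) :
    H (g b) * η b - H (g a) * η a =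
      ∫ s in a..b, (deriv H (g s) * n s * η s + H (g s) * deriv η s) := by
  -- the absolutely continuous representative `P = g(a) + ∫ₐ n` of `g` on `[a, b]`
  set P : ℝ → ℝ := fun s => g a + ∫ r in a..s, n r with hP
  have hPI : AbsolutelyContinuousOnInterval (fun s => ∫ r in a..s, n r) a b :=
    hn.absolutelyContinuousOnInterval_intervalIntegral (by simp [hab])
  have hPac : AbsolutelyContinuousOnInterval P a b :=
    ((contDiffOn_const (c := g a)).absolutelyContinuousOnInterval).add hPI
  have hgP : ∀ s ∈ Icc a b, g s = P s := hg
  have hPa : P a = g a := by simp [hP]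
  have hPb : P b = g b := (hgP b ⟨hab, le_rfl⟩).symm
  -- `H ∘ P` is absolutely continuous: `P` is bounded and `H` is Lipschitz on bounded intervals
  obtain ⟨C, hC⟩ := hPac.exists_bound
  obtain ⟨K, hK⟩ := (hH.contDiffOn (s := Icc (-C) C)).exists_lipschitzOnWith one_ne_zero
    (convex_Icc _ _) isCompact_Icc
  have hmaps : MapsTo P (uIcc a b) (Icc (-C) C) := fun s hs => by
    have h := hC s hs
    rw [Real.norm_eq_abs, abs_le] at h
    exact h
  have hHP : AbsolutelyContinuousOnInterval (fun s => H (P s)) a b :=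
    hPac.comp_of_lipschitzOnWith hK hmaps
  have hηac : AbsolutelyContinuousOnInterval η a b := hη.contDiffOn.absolutelyContinuousOnInterval
  -- the product `F = (H ∘ P) η` and the fundamental theorem of calculus
  set F : ℝ → ℝ := fun s => H (P s) * η s with hF
  have hFac : AbsolutelyContinuousOnInterval F a b := hHP.mul hηac
  have hFTC := hFac.integral_deriv_eq_sub
  -- `F' = H'(P) n η + H(P) η'` a.e. on `[a, b]`
  have hHd : ∀ y, HasDerivAt H (deriv H y) y := fun y =>
    ((hH.differentiable one_ne_zero) y).hasDerivAt
  have hηd : ∀ s, HasDerivAt η (deriv η s) s := fun s =>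
    ((hη.differentiable one_ne_zero) s).hasDerivAt
  have hderiv : ∀ᵐ s, s ∈ uIoc a b →
      deriv F s = deriv H (g s) * n s * η s + H (g s) * deriv η s := by
    filter_upwards [hn.ae_hasDerivAt_integral] with s hs hsmem
    have hs' : s ∈ uIcc a b := uIoc_subset_uIcc hsmem
    have hsIcc : s ∈ Icc a b := by rwa [uIcc_of_le hab] at hs'
    have hPd : HasDerivAt P (n s) s := by
      have h := (hs hs' a (by simp)).const_add (g a)
      exact h
    have hHPd : HasDerivAt (fun t => H (P t)) (deriv H (P s) * n s) s :=
      (hHd (P s)).comp s hPd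
    have hFd : HasDerivAt F (deriv H (P s) * n s * η s + H (P s) * deriv η s) s :=
      hHPd.mul (hηd s)
    rw [hFd.deriv, ← hgP s hsIcc]
  rw [intervalIntegral.integral_congr_ae hderiv] at hFTC
  rw [hFTC, hF]
  simp only [hPa, hPb]

/-- **The integrated chain rule under the integral sign (the energy identity in time).** Let
`μ` be a σ-finite measure on `X`, `w : X → ℝ` a weight, `H, η ∈ C¹(ℝ)`, and `g, n : ℝ → X → ℝ`
with, for every `x`, `n(·, x)` integrable on `[a, b]` and `g(s, x) = g(a, x) + ∫ₐˢ n(τ, x) dτ`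
for `s ∈ [a, b]` (the time-integrated form of `∂ₜ g = n`). If
`(s, x) ↦ (H'(g) n η + H(g) η')(s, x) w(x)` is integrable on `(a, b] × X`, then
`∫ (H(g(b,x)) η(b) − H(g(a,x)) η(a)) w(x) dμ = ∫ₐᵇ ∫ (H'(g) n η + H(g) η')(s, x) w(x) dμ ds`
(`comp_mul_sub_comp_mul_eq_integral` at each `x`, then Fubini). With `H(v) = |v|^{2q}`,
`η` a time cut-off and `w = φ_R²` this is (2.2)–(2.3) of Lei–Zhang 2011 for the swirl equation
in the time-integrated form of `KNSS2009_regularity_axisymmetric_swirl`. [cite: LeiZhang2011, §2 (2.2)–(2.3) (arXiv p. 6)] -/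
theorem integral_comp_mul_sub_eq_integral_integral {X : Type*} [MeasurableSpace X]
    {μ : Measure X} [SigmaFinite μ] {g n : ℝ → X → ℝ} {a b : ℝ} (hab : a ≤ b)
    (hn : ∀ x, IntervalIntegrable (fun s => n s x) volume a b)
    (hg : ∀ x, ∀ s ∈ Icc a b, g s x = g a x + ∫ r in a..s, n r x)
    {H : ℝ → ℝ} (hH : ContDiff ℝ 1 H) {η : ℝ → ℝ} (hη : ContDiff ℝ 1 η) (w : X → ℝ)
    (hint : Integrable (fun p : ℝ × X =>
      (deriv H (g p.1 p.2) * n p.1 p.2 * η p.1 + H (g p.1 p.2) * deriv η p.1) * w p.2)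
      ((volume.restrict (Ioc a b)).prod μ)) :
    ∫ x, (H (g b x) * η b - H (g a x) * η a) * w x ∂μ =
      ∫ s in a..b, ∫ x, (deriv H (g s x) * n s x * η s + H (g s x) * deriv η s) * w x ∂μ := by
  -- pointwise in `x`: the integrated chain rule
  have hpt : ∀ x, (H (g b x) * η b - H (g a x) * η a) * w x =
      ∫ s in Ioc a b, (deriv H (g s x) * n s x * η s + H (g s x) * deriv η s) * w x := by
    intro x
    rw [comp_mul_sub_comp_mul_eq_integral hab (hn x) (hg x) hH hη, ← integral_of_le hab,
      intervalIntegral.integral_mul_const]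
  simp_rw [hpt]
  -- Fubini
  have hswap : Integrable (Function.uncurry fun (x : X) (s : ℝ) =>
      (deriv H (g s x) * n s x * η s + H (g s x) * deriv η s) * w x)
      (μ.prod (volume.restrict (Ioc a b))) := by
    have h := hint.swap
    exact h
  rw [integral_integral_swap hswap, integral_of_le hab]

/-- **The integrated chain rule under the integral sign, with almost-everywhere hypotheses**:
the same as `integral_comp_mul_sub_eq_integral_integral`, assuming the time-integrated equation
`g(s, x) = g(a, x) + ∫ₐˢ n(τ, x) dτ` only for `μ`-a.e. `x` (e.g. off the axis for the swirl
equation (5.10), which is stated for `r(x) ≠ 0`). [cite: LeiZhang2011, §2 (2.2)–(2.3) (arXiv p. 6)] -/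
theorem integral_comp_mul_sub_eq_integral_integral_ae {X : Type*} [MeasurableSpace X]
    {μ : Measure X} [SigmaFinite μ] {g n : ℝ → X → ℝ} {a b : ℝ} (hab : a ≤ b)
    (hgn : ∀ᵐ x ∂μ, IntervalIntegrable (fun s => n s x) volume a b ∧
      ∀ s ∈ Icc a b, g s x = g a x + ∫ r in a..s, n r x)
    {H : ℝ → ℝ} (hH : ContDiff ℝ 1 H) {η : ℝ → ℝ} (hη : ContDiff ℝ 1 η) (w : X → ℝ)
    (hint : Integrable (fun p : ℝ × X =>
      (deriv H (g p.1 p.2) * n p.1 p.2 * η p.1 + H (g p.1 p.2) * deriv η p.1) * w p.2)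
      ((volume.restrict (Ioc a b)).prod μ)) :
    ∫ x, (H (g b x) * η b - H (g a x) * η a) * w x ∂μ =
      ∫ s in a..b, ∫ x, (deriv H (g s x) * n s x * η s + H (g s x) * deriv η s) * w x ∂μ := by
  -- a.e. in `x`: the integrated chain rule
  have hpt : ∀ᵐ x ∂μ, (H (g b x) * η b - H (g a x) * η a) * w x =
      ∫ s in Ioc a b, (deriv H (g s x) * n s x * η s + H (g s x) * deriv η s) * w x := by
    filter_upwards [hgn] with x hx
    rw [comp_mul_sub_comp_mul_eq_integral hab hx.1 hx.2 hH hη, ← integral_of_le hab,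
      intervalIntegral.integral_mul_const]
  rw [integral_congr_ae hpt]
  -- Fubini
  have hswap : Integrable (Function.uncurry fun (x : X) (s : ℝ) =>
      (deriv H (g s x) * n s x * η s + H (g s x) * deriv η s) * w x)
      (μ.prod (volume.restrict (Ioc a b))) := hint.swap
  rw [integral_integral_swap hswap, integral_of_le hab]

end Literature.Analysis.FluidPDE
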